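import Summits.Langlands.Langlands.Theorems.SqrtFiveQuarticCoversCertB3E7Infinity

/-!
# Route `Langlands/SqrtFiveQuarticCovers`, certificate `CertB3E7` (sheet 4.5, carrier `X(b3,e7)`) —
# the GROUP-LAW HALF of the named input NF-E10-MW (`MordellWeilE7`) IN THE KERNEL
# (cell `pub/lg-quartmod`, F-L1, NAMED-INPUT TABLE row 8 / seat E7-MW-GROUPLAW; CONDITIONAL bookkeeping)

Companion to `Theorems/SqrtFiveQuarticCoversCertB3E7.lean` (p670569) and
`…CertB3E7Infinity.lean` (p672401), both untouched.  There the named input `hE49` = NF-E10-MW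
(registered stub «MordellWeilE7» of item stmt-Langlands-23416) reads: for `K` a quartic number
field, `r ∈ K`, `r² = 5`, `σ ≠ id` a ring endomorphism of `K` fixing `r`, and `(x, y) ∈ X(e7)(K)`,
`y² = 7q(x)`, `q = 16x⁴ + 68x³ + 111x² + 62x + 11` [cite: FreitasLeHungSiksek2015, Lemma 4.2 (p. 28)]:
`σx = x` or `(12x + 5)·σx = −(5x + 2)`.  Its docstring justification is «`Q + Q^σ ∈ X(e7)(k) = {O, T₀}`,
`x(T₀ − Q) = x(Q)`, `x(−Q) = m(x(Q))`», i.e. TWO ingredients: (i) the finite datum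
`X(e7)(ℚ(√5)) = {(−1/3, ±14/9)}` (rank `0` of `49a4` and of `49a4 ⊗ χ₅` from the EXACT non-vanishing
`L(49a,1)·L(49a⊗χ₅,1) ≠ 0`, certnum RELEASES l.140 (RQ-027 K1 LV0, K2 TORE), Kolyvagin–Logachev —
NAMED, not proved in any tree) and (ii) the group law of the genus-one curve `X(e7)` read on the
coordinate `x`.

This file PROVES (ii) in the kernel and leaves exactly (i) as the hypothesis, in its barest form
`hE7k`: «for `K` quartic with `r ∈ K`, `r² = 5`: every point `(x, y)` of `y² = 7q(x)` with BOTH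
coordinates in `ℚ + ℚ·r` has `3x + 1 = 0`» (the `x`-coordinate reading of
`X(e7)(ℚ(√5)) = {(−1/3, ±14/9)}`; no `σ`, no group law, no `y`-values used).  Main theorem:
`mordellWeilE7_of_kPoints (hE7k) : <the type of hE49 / stub MordellWeilE7, VERBATIM>`, and the
compositions `certB3E7_of_modelIdentification_of_kPoints_of_census` /
`certB3E7_of_modelIdentification_inf_of_kPoints_of_census : … → CertB3E7` BY NAME, so that sheet 4.5
rests on {model identification NF-K1-E10 (resp. the weaker NF-K1-E10∞), the bare `k`-point list
`hE7k`, the certified census `CensusMM`, `CensusMI`}.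

METHOD (elementary algebra; no Jacobian, no Weierstrass-group API).
1. `ringHom_fixing_sqrt_five_sq_eq_id`: ANY ring endomorphism `σ ≠ id` of the quartic `K` fixing `r`
   is the generator of `Gal(K/ℚ(r))`: `σ ∘ σ = id` and `K^σ = ℚ + ℚ·r` (the tree's
   `exists_ringHom_ne_id_fixing_sqrt_five` gives this for ONE `σ`; `hE49` quantifies over all).
2. For `P = (x, y) ∈ X(e7)(K)` with `σx ≠ x` (so `x, σx ≠ −1/3`): the parabola
   `Y = g(X) = aX² + bX + c` through `O = (−1/3, 14/9)`, `P`, `σP` (Lagrange) has `σ`-invariant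
   coefficients, so `a, b, c ∈ ℚ + ℚ·r` and `a² ≠ 112` (`112` and `560` are not squares:
   `sq_ne_112_of_mem_span_sqrt_five`).  The quartic `h(X) = g(X)² − 7q(X)` (leading coefficient
   `a² − 112 ≠ 0`) vanishes at the three distinct points `−1/3, x, σx`; the kernel identity
   `quartic_vieta_of_three_roots` («three roots ⇒ the Vieta fourth root `x₃` is a root, and the low
   coefficients are the elementary symmetric functions», proved by `linear_combination` with the
   Lagrange-basis certificate) produces the fourth intersection point `(x₃, g(x₃)) ∈ X(e7)(K)`, which
   is `σ`-fixed, hence has both coordinates in `ℚ + ℚ·r`; by `hE7k`, `x₃ = −1/3`.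
3. So `−1/3` is a DOUBLE root of `h`: `O + P + σP + O ∼ 2·D_∞`.  Eliminating the symmetric functions
   of `x, σx` from the coefficient identities (`e7_neg_relation`: tangency `9c = a + 70`,
   `3b = 2a + 56`, then Vieta) gives `12·x·σx + 5(x + σx) + 2 = 0`, i.e. `(12x + 5)·σx = −(5x + 2)`
   — the Möbius involution `m(x) = −(5x+2)/(12x+5)` = negation for the origin `O` read on `x`
   (E10-REPORT j313617; E10-TWIN row 5).  Geometrically: `2D_∞ ∼ 2O + 2T` (`T = (−1/3, −14/9)`), so
   `P + σP = O` in `Pic⁰`, `σP = −P`; the other value `P + σP = T` of the docstring is exactly the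
   excluded case `σx = x` (`σP = T − P = ι P`, `ι(x,y) = (x,−y)`).
(Every polynomial certificate was checked exactly beforehand: cell files
`HOME/lg-quartmod-eng-8/code/e7mw/verify_{generic,specific,lc}.py`.)
HONEST STATUS: conditional bookkeeping over one explicit quartic family (totally real `K ∋ √5` in
the assembly; this file needs no total reality).  The remaining hypothesis `hE7k` is a rank-`0`
finite datum resting on Kolyvagin–Logachev and exact `L`-values (certnum l.140) — NAMED, not proved;
the model identification and the certified census stay named as in p670569 / p672401.  «A certified
finite datum is not a modularity or BSD statement»; nothing here proves modularity of a new class of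
elliptic curves.
References: [FreitasLeHungSiksek2015] Lemma 4.2, p. 28 (arXiv:1310.7088); [SilvermanAEC2009] III.2–3;
cell record CENSUS.md §15 row 4.5, NAMED-INPUT TABLE v1.1 (e4a04d1b325e7b4b) row 8.
-/

set_option linter.dupNamespace false -- project-wide option (lakefile weak.linter.dupNamespace); `Summit.Langlands.Langlands` is the mandated namespace

namespace Summit.Langlands.Langlands.Theorems.SqrtFiveQuarticCovers

open scoped Matrix IntermediateField
open Polynomial

/-! ## 1. Field theory: every `σ ≠ id` fixing `r` is the quadratic automorphism -/

/-- **Any ring endomorphism `σ ≠ id` of a quartic number field `K` fixing `r`, `r² = 5`, is the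
generator of `Gal(K/ℚ(r))`:** `σ (σ z) = z` for all `z`, and every `σ`-fixed element is `a + b·r`
with `a b : ℚ`.  (`σ` is `ℚ(r)`-linear, hence — `K/ℚ(r)` being finite — an automorphism; the
automorphism group of the quadratic, hence Galois, extension `K/ℚ(r)` is `{1, σ}`; Galois
correspondence.)  Strengthens `exists_ringHom_ne_id_fixing_sqrt_five` (which produces one such `σ`)
to the universally quantified form in which the named input `MordellWeilE7` is stated. [folklore] -/
theorem ringHom_fixing_sqrt_five_sq_eq_id {K : Type} [Field K] [NumberField K]
    (hd : Module.finrank ℚ K = 4) {r : K} (hr : r ^ 2 = 5) (σ : K →+* K) (hσr : σ r = r)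
    (hσ : σ ≠ RingHom.id K) :
    (∀ z : K, σ (σ z) = z) ∧ (∀ z : K, σ z = z → ∃ a b : ℚ, z = (a : K) + (b : K) * r) := by
  have hr_int : IsIntegral ℚ r := Algebra.IsIntegral.isIntegral r
  have hF2 : Module.finrank ℚ ℚ⟮r⟯ = 2 := by
    rw [IntermediateField.adjoin.finrank hr_int, minpoly_eq_X_sq_sub_five hr, natDegree_X_pow_sub_C]
  have hFK : Module.finrank ℚ⟮r⟯ K = 2 := by
    have h := Module.finrank_mul_finrank ℚ ℚ⟮r⟯ K
    rw [hF2, hd] at h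
    omega
  haveI : Algebra.IsQuadraticExtension ℚ⟮r⟯ K := ⟨hFK⟩
  haveI : IsGalois ℚ⟮r⟯ K := inferInstance
  haveI : FiniteDimensional ℚ⟮r⟯ K := Module.Finite.of_restrictScalars_finite ℚ ℚ⟮r⟯ K
  -- `σ` is `ℚ(r)`-linear
  have hcomm : ∀ z : ℚ⟮r⟯, σ (z : K) = z := by
    intro z
    obtain ⟨a, b, hab⟩ := exists_rat_add_rat_mul_of_mem_adjoin_sqrt_five hr z.2
    rw [hab, map_add, map_mul, map_ratCast, map_ratCast, hσr]
  let σₐ : K →ₐ[ℚ⟮r⟯] K := { σ with commutes' := fun z => hcomm z }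
  let σₑ : K ≃ₐ[ℚ⟮r⟯] K := AlgEquiv.ofBijective σₐ (Algebra.IsAlgebraic.algHom_bijective σₐ)
  have hσₑ : ∀ z : K, σₑ z = σ z := fun z => rfl
  -- the Galois group is `{1, σ₀}`
  have hcard : Nat.card (K ≃ₐ[ℚ⟮r⟯] K) = 2 := by
    rw [IsGalois.card_aut_eq_finrank, hFK]
  obtain ⟨σ₀, hσ₀, huniq⟩ := (Nat.card_eq_two_iff' (1 : K ≃ₐ[ℚ⟮r⟯] K)).1 hcard
  have hall : ∀ g : K ≃ₐ[ℚ⟮r⟯] K, g = 1 ∨ g = σ₀ := fun g => by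
    by_cases hg : g = 1
    · exact Or.inl hg
    · exact Or.inr (huniq g hg)
  have hσₑ1 : σₑ ≠ 1 := by
    intro h
    apply hσ
    ext z
    have hz : σₑ z = z := by rw [h, AlgEquiv.one_apply]
    rw [hσₑ] at hz
    exact hz
  have hσₑ0 : σₑ = σ₀ := (hall σₑ).resolve_left hσₑ1
  have hsq : σₑ * σₑ = 1 := by
    rcases hall (σₑ * σₑ) with h | h
    · exact h
    · exfalso
      apply hσₑ1
      rw [← hσₑ0] at h
      exact mul_left_cancel (a := σₑ) (by rw [h, mul_one])
  refine ⟨fun z => ?_, fun z hz => ?_⟩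
  · have h1 : (σₑ * σₑ) z = z := by rw [hsq, AlgEquiv.one_apply]
    rwa [AlgEquiv.mul_apply, hσₑ, hσₑ] at h1
  · have hfix : ∀ f : K ≃ₐ[ℚ⟮r⟯] K, f z = z := by
      intro f
      rcases hall f with rfl | rfl
      · rfl
      · rw [← hσₑ0, hσₑ]; exact hz
    have hmem : z ∈ (⊥ : IntermediateField ℚ⟮r⟯ K) := (IsGalois.mem_bot_iff_fixed z).2 hfix
    rw [IntermediateField.mem_bot] at hmem
    obtain ⟨z', hz'⟩ := hmem
    obtain ⟨a, b, hab⟩ := exists_rat_add_rat_mul_of_mem_adjoin_sqrt_five hr z'.2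
    refine ⟨a, b, ?_⟩
    rw [← hz', ← hab]
    rfl

/-- `k² < n < (k+1)²` ⇒ `n` is not a perfect square (own copy; the one in `…CertB3E7Infinity` is
private). [folklore] -/
theorem nat_not_isSquare_of_between_squares {n k : ℕ} (h1 : k ^ 2 < n) (h2 : n < (k + 1) ^ 2) :
    ¬ IsSquare n := by
  rintro ⟨m, rfl⟩
  have hkm : k < m := by nlinarith
  have hmk : m < k + 1 := by nlinarith
  omega

/-- **`112 = 16·7` is not a square in `ℚ(√5)`:** `(a + b·r)² ≠ 112` for `a b : ℚ`, `r² = 5`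
(else `112` or `560` would be a perfect square, `isSquare_or_isSquare_five_mul_of_sq_eq`;
`10² < 112 < 11²`, `23² < 560 < 24²`).  This is «no `k`-point at infinity on `y² = 112x⁴ + …`» and,
here, «the `k`-rational parabola `Y = aX² + bX + c` is never asymptotic to `X(e7)`». [folklore] -/
theorem sq_ne_112_of_mem_span_sqrt_five {K : Type} [Field K] [CharZero K] {r : K} (hr : r ^ 2 = 5)
    (a b : ℚ) : ((a : K) + (b : K) * r) ^ 2 ≠ 112 := by
  intro h
  have h' : ((a : K) + (b : K) * r) ^ 2 = ((112 : ℕ) : K) := by rw [h]; norm_num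
  rcases isSquare_or_isSquare_five_mul_of_sq_eq hr h' with h1 | h1
  · exact nat_not_isSquare_of_between_squares (k := 10) (by norm_num) (by norm_num) h1
  · exact nat_not_isSquare_of_between_squares (k := 23) (by norm_num) (by norm_num) h1

/-! ## 2. Kernel algebra: a quartic with three known roots; Lagrange interpolation -/

/-- **Three distinct roots of a quartic determine it** (Vieta): if
`h(X) = h₄X⁴ + h₃X³ + h₂X² + h₁X + h₀` vanishes at distinct `u, v, w`, then with
`T := −h₃ − h₄(u + v + w)` (`= h₄·t`, `t` the fourth root) one has `h₀ = uvw·T`,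
`h₁ = −h₄uvw − (uv + uw + vw)T`, `h₂ = h₄(uv + uw + vw) + (u + v + w)T`, and `h(t) = 0` whenever
`h₄t = T`.  (Proof: the remainder `h − h₄(X−u)(X−v)(X−w)(X−t)` has degree `≤ 2` and three roots;
each identity is `(u−v)(u−w)(v−w)·(…) =` an explicit combination of `h(u), h(v), h(w)` — the
Lagrange-basis certificate, checked by `linear_combination`.) [folklore] -/
theorem quartic_vieta_of_three_roots {F : Type} [Field F] {h₀ h₁ h₂ h₃ h₄ u v w : F}
    (hu : h₄ * u ^ 4 + h₃ * u ^ 3 + h₂ * u ^ 2 + h₁ * u + h₀ = 0)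
    (hv : h₄ * v ^ 4 + h₃ * v ^ 3 + h₂ * v ^ 2 + h₁ * v + h₀ = 0)
    (hw : h₄ * w ^ 4 + h₃ * w ^ 3 + h₂ * w ^ 2 + h₁ * w + h₀ = 0)
    (huv : u ≠ v) (huw : u ≠ w) (hvw : v ≠ w) :
    h₀ = u * v * w * (-h₃ - h₄ * (u + v + w)) ∧
    h₁ = -(h₄ * (u * v * w)) - (u * v + u * w + v * w) * (-h₃ - h₄ * (u + v + w)) ∧
    h₂ = h₄ * (u * v + u * w + v * w) + (u + v + w) * (-h₃ - h₄ * (u + v + w)) ∧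
    ∀ t : F, h₄ * t = -h₃ - h₄ * (u + v + w) →
      h₄ * t ^ 4 + h₃ * t ^ 3 + h₂ * t ^ 2 + h₁ * t + h₀ = 0 := by
  have hD : (u - v) * (u - w) * (v - w) ≠ 0 :=
    mul_ne_zero (mul_ne_zero (sub_ne_zero.2 huv) (sub_ne_zero.2 huw)) (sub_ne_zero.2 hvw)
  have e0 : (u - v) * (u - w) * (v - w) * (h₀ - u * v * w * (-h₃ - h₄ * (u + v + w))) = 0 := by
    linear_combination (v * w * (v - w)) * hu - (u * w * (u - w)) * hv + (u * v * (u - v)) * hw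
  have e1 : (u - v) * (u - w) * (v - w) *
      (h₁ - (-(h₄ * (u * v * w)) - (u * v + u * w + v * w) * (-h₃ - h₄ * (u + v + w)))) = 0 := by
    linear_combination (-(v + w) * (v - w)) * hu + ((u + w) * (u - w)) * hv - ((u + v) * (u - v)) * hw
  have e2 : (u - v) * (u - w) * (v - w) *
      (h₂ - (h₄ * (u * v + u * w + v * w) + (u + v + w) * (-h₃ - h₄ * (u + v + w)))) = 0 := by
    linear_combination (v - w) * hu - (u - w) * hv + (u - v) * hw
  have E0 := sub_eq_zero.1 ((mul_eq_zero.1 e0).resolve_left hD)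
  have E1 := sub_eq_zero.1 ((mul_eq_zero.1 e1).resolve_left hD)
  have E2 := sub_eq_zero.1 ((mul_eq_zero.1 e2).resolve_left hD)
  refine ⟨E0, E1, E2, fun t ht => ?_⟩
  linear_combination t ^ 2 * E2 + t * E1 + E0 + ((t - u) * (t - v) * (t - w)) * ht

/-- Evaluation of a quadratic with coefficients `A/D, B/D, C/D` (Lagrange interpolation with the
common denominator `D = (u−v)(u−w)(v−w)`). [folklore] -/
theorem quad_div_eval {F : Type} [Field F] {D A B C X Y : F} (hD : D ≠ 0)
    (h : A * X ^ 2 + B * X + C = D * Y) : A / D * X ^ 2 + B / D * X + C / D = Y := by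
  field_simp
  linear_combination h

/-! ## 3. The curve `X(e7)`: negation for the origin `O = (−1/3, 14/9)` read on `x` -/

/-- **The double root at `O` forces `x(σP) = m(x(P))`.**  For the parabola `Y = aX² + bX + c`
through `O = (−1/3, 14/9)` (`hg₀`) and the quartic `h = (aX²+bX+c)² − 7q(X)` with roots
`−1/3, v, w` (its low Vieta identities `hE0`, `hE1` from `quartic_vieta_of_three_roots`) whose Vieta
fourth root is AGAIN `−1/3` (`hX3`: `(a² − 112)·(−1/3) = T`), and `a² ≠ 112`:
`(12v + 5)·w = −(5v + 2)`.  Chain (each step a checked `linear_combination`): `(a²−112)(v+w) =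
−(2ab−476) + ⅔(a²−112)`, `(a²−112)vw = 9(c²−77)`, the tangency relation
`2a² − 6ab + 54bc − 162c² + 1960 = 0`, whence with `hg₀`: `9c = a + 70`, `3b = 2a + 56`, and finally
`(a²−112)·(12vw + 5(v+w) + 2) = ⅓[324c² − 30ab + 16a² − 19600] = 0`. [folklore] -/
theorem e7_neg_relation {K : Type} [Field K] [CharZero K] {a b c v w : K}
    (hg₀ : a * (-1 / 3) ^ 2 + b * (-1 / 3) + c = 14 / 9)
    (hE0 : c ^ 2 - 77 = -1 / 3 * v * w * (-(2 * a * b - 476) - (a ^ 2 - 112) * (-1 / 3 + v + w)))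
    (hE1 : 2 * b * c - 434 = -((a ^ 2 - 112) * (-1 / 3 * v * w)) -
      (-1 / 3 * v + -1 / 3 * w + v * w) * (-(2 * a * b - 476) - (a ^ 2 - 112) * (-1 / 3 + v + w)))
    (hX3 : (a ^ 2 - 112) * (-1 / 3) = -(2 * a * b - 476) - (a ^ 2 - 112) * (-1 / 3 + v + w))
    (ha : a ^ 2 - 112 ≠ 0) : (12 * v + 5) * w = -(5 * v + 2) := by
  have hS : (a ^ 2 - 112) * (v + w) = -(2 * a * b - 476) + 2 / 3 * (a ^ 2 - 112) := by
    linear_combination hX3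
  have hP : (a ^ 2 - 112) * (v * w) = 9 * (c ^ 2 - 77) := by
    linear_combination (-9) * hE0 - (3 * v * w) * hX3
  have hR1 : 2 * a ^ 2 - 6 * a * b + 54 * b * c - 162 * c ^ 2 + 1960 = 0 := by
    linear_combination 27 * hE1 - (9 * v + 9 * w + 27 * v * w + 3) * hX3 - 162 * hE0
  have htang : a - 9 * c + 70 = 0 := by
    linear_combination (1 / 28) * hR1 - (9 * (a - 9 * c) / 14) * hg₀
  have he2 : 3 * b - 2 * a - 56 = 0 := by
    linear_combination (-9) * hg₀ - htang
  have hkey : (a ^ 2 - 112) * (12 * (v * w) + 5 * (v + w) + 2) = 0 := by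
    linear_combination 12 * hP + 5 * hS - ((4 * a + 36 * c + 280) / 3) * htang - (10 * a / 3) * he2
  have h := (mul_eq_zero.1 hkey).resolve_left ha
  linear_combination h

/-! ## 4. `MordellWeilE7` (NF-E10-MW) from the bare `k`-point list -/

/-- **E7-MW-GROUPLAW: the named input NF-E10-MW (`hE49`, registered stub «MordellWeilE7» of
stmt-Langlands-23416; conclusion = its type VERBATIM) from the bare point list read on `x`.**
Hypothesis `hE7k` (NAMED — the rank-`0` finite datum `X(e7)(ℚ(√5)) = {(−1/3, ±14/9)}`:
`L(49a,1)·L(49a⊗χ₅,1) ≠ 0` exactly, certnum RELEASES l.140 RQ-027 K1/K2, + Kolyvagin–Logachev;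
lineages eng-8 j313093/j313052, eng-3 E10-TWIN): for `K` a quartic number field, `r ∈ K`, `r² = 5`,
every `(x, y)` with `x, y ∈ ℚ + ℚ·r` on `y² = 7(16x⁴+68x³+111x²+62x+11)` has `3x + 1 = 0`.
Conclusion: for every ring endomorphism `σ ≠ id` of `K` fixing `r` and every `(x, y) ∈ X(e7)(K)`,
`σx = x` or `(12x+5)σx = −(5x+2)`.  Proof: §1–§3 of this file (the module docstring's METHOD): the
`k`-rational parabola through `O, P, σP` meets `X(e7)` in a fourth point, `k`-rational hence `= O` by
`hE7k`; the resulting double root at `O` gives `x(σP) = m(x(P))`.  CONDITIONAL on `hE7k` only.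
[cite: FreitasLeHungSiksek2015, Lemma 4.2 (p. 28)] [cite: SilvermanAEC2009, III.2–III.3] -/
theorem mordellWeilE7_of_kPoints
    (hE7k : ∀ (K : Type) [Field K] [NumberField K], Module.finrank ℚ K = 4 → ∀ r : K, r ^ 2 = 5 →
        ∀ x y : K, (∃ a b : ℚ, x = (a : K) + (b : K) * r) → (∃ a b : ℚ, y = (a : K) + (b : K) * r) →
          y ^ 2 = 7 * (16 * x ^ 4 + 68 * x ^ 3 + 111 * x ^ 2 + 62 * x + 11) → 3 * x + 1 = 0) :
    ∀ (K : Type) [Field K] [NumberField K], Module.finrank ℚ K = 4 → ∀ r : K, r ^ 2 = 5 →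
        ∀ σ : K →+* K, σ r = r → σ ≠ RingHom.id K →
          ∀ x y : K, y ^ 2 = 7 * (16 * x ^ 4 + 68 * x ^ 3 + 111 * x ^ 2 + 62 * x + 11) →
            (σ x = x ∨ (12 * x + 5) * σ x = -(5 * x + 2)) := by
  intro K _ _ hd r hr σ hσr hσ x y hy
  by_cases hx : σ x = x
  · exact Or.inl hx
  right
  obtain ⟨hinv, hfix⟩ := ringHom_fixing_sqrt_five_sq_eq_id hd hr σ hσr hσ
  -- `σP = (σ x, σ y)` lies on the curve
  have hy' : (σ y) ^ 2 = 7 * (16 * (σ x) ^ 4 + 68 * (σ x) ^ 3 + 111 * (σ x) ^ 2 + 62 * (σ x) + 11) := by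
    have h := congrArg σ hy
    simp only [map_pow, map_mul, map_add, map_ofNat] at h
    exact h
  -- the three `x`-coordinates `−1/3, x, σ x` are distinct
  have hvw : x ≠ σ x := fun h => hx h.symm
  have h3x : 3 * x + 1 ≠ 0 := by
    intro h
    apply hx
    have hx' : x = -1 / 3 := by linear_combination h / 3
    rw [hx', map_div₀, map_neg, map_one, map_ofNat]
  have h3σx : 3 * σ x + 1 ≠ 0 := by
    intro h
    apply h3x
    have h' : σ (3 * x + 1) = σ 0 := by rw [map_add, map_mul, map_ofNat, map_one, map_zero, h]
    exact σ.injective h'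
  have huv : (-1 / 3 : K) ≠ x := fun h => h3x (by linear_combination (-3) * h)
  have huw : (-1 / 3 : K) ≠ σ x := fun h => h3σx (by linear_combination (-3) * h)
  have hD : (-1 / 3 - x) * (-1 / 3 - σ x) * (x - σ x) ≠ 0 :=
    mul_ne_zero (mul_ne_zero (sub_ne_zero.2 huv) (sub_ne_zero.2 huw)) (sub_ne_zero.2 hvw)
  -- `σ` acts on the Lagrange data by `x ↔ σ x`, `y ↔ σ y`
  have hσc : ∀ q : ℚ, σ (q : K) = q := fun q => map_ratCast σ q
  have hσu : σ (-1 / 3 : K) = -1 / 3 := by rw [map_div₀, map_neg, map_one, map_ofNat]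
  have hσy₀ : σ (14 / 9 : K) = 14 / 9 := by rw [map_div₀, map_ofNat, map_ofNat]
  -- the parabola `Y = aX² + bX + c` through `O = (−1/3, 14/9)`, `P`, `σP`, with `σ`-fixed coefficients
  obtain ⟨a, b, c, hg₀, hg₁, hg₂, hσa, hσb, hσcc⟩ : ∃ a b c : K,
      a * (-1 / 3) ^ 2 + b * (-1 / 3) + c = 14 / 9 ∧ a * x ^ 2 + b * x + c = y ∧
      a * (σ x) ^ 2 + b * (σ x) + c = σ y ∧ σ a = a ∧ σ b = b ∧ σ c = c := by
    have hσD : σ ((-1 / 3 - x) * (-1 / 3 - σ x) * (x - σ x)) =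
        -((-1 / 3 - x) * (-1 / 3 - σ x) * (x - σ x)) := by
      simp only [map_mul, map_sub, hσu, hinv]; ring
    have hσA : σ (14 / 9 * (x - σ x) - y * (-1 / 3 - σ x) + σ y * (-1 / 3 - x)) =
        -(14 / 9 * (x - σ x) - y * (-1 / 3 - σ x) + σ y * (-1 / 3 - x)) := by
      simp only [map_add, map_sub, map_mul, hσu, hσy₀, hinv]; ring
    have hσB : σ (-(14 / 9 * (x + σ x) * (x - σ x) - y * (-1 / 3 + σ x) * (-1 / 3 - σ x) +
        σ y * (-1 / 3 + x) * (-1 / 3 - x))) = -(-(14 / 9 * (x + σ x) * (x - σ x) -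
        y * (-1 / 3 + σ x) * (-1 / 3 - σ x) + σ y * (-1 / 3 + x) * (-1 / 3 - x))) := by
      simp only [map_neg, map_add, map_sub, map_mul, hσu, hσy₀, hinv]; ring
    have hσC : σ (14 / 9 * x * σ x * (x - σ x) - y * (-1 / 3) * σ x * (-1 / 3 - σ x) +
        σ y * (-1 / 3) * x * (-1 / 3 - x)) = -(14 / 9 * x * σ x * (x - σ x) -
        y * (-1 / 3) * σ x * (-1 / 3 - σ x) + σ y * (-1 / 3) * x * (-1 / 3 - x)) := by
      simp only [map_add, map_sub, map_mul, hσu, hσy₀, hinv]; ring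
    refine ⟨(14 / 9 * (x - σ x) - y * (-1 / 3 - σ x) + σ y * (-1 / 3 - x)) /
        ((-1 / 3 - x) * (-1 / 3 - σ x) * (x - σ x)),
      (-(14 / 9 * (x + σ x) * (x - σ x) - y * (-1 / 3 + σ x) * (-1 / 3 - σ x) +
        σ y * (-1 / 3 + x) * (-1 / 3 - x))) / ((-1 / 3 - x) * (-1 / 3 - σ x) * (x - σ x)),
      (14 / 9 * x * σ x * (x - σ x) - y * (-1 / 3) * σ x * (-1 / 3 - σ x) +
        σ y * (-1 / 3) * x * (-1 / 3 - x)) / ((-1 / 3 - x) * (-1 / 3 - σ x) * (x - σ x)),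
      quad_div_eval hD (by ring), quad_div_eval hD (by ring), quad_div_eval hD (by ring), ?_, ?_, ?_⟩
    · rw [map_div₀, hσA, hσD, neg_div_neg_eq]
    · rw [map_div₀, hσB, hσD, neg_div_neg_eq]
    · rw [map_div₀, hσC, hσD, neg_div_neg_eq]
  -- the quartic `h = (aX²+bX+c)² − 7q(X)` vanishes at `−1/3, x, σ x`
  have Hu : (a ^ 2 - 112) * (-1 / 3) ^ 4 + (2 * a * b - 476) * (-1 / 3) ^ 3 +
      (b ^ 2 + 2 * a * c - 777) * (-1 / 3) ^ 2 + (2 * b * c - 434) * (-1 / 3) + (c ^ 2 - 77) = 0 := by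
    linear_combination (a * (-1 / 3) ^ 2 + b * (-1 / 3) + c + 14 / 9) * hg₀
  have Hv : (a ^ 2 - 112) * x ^ 4 + (2 * a * b - 476) * x ^ 3 + (b ^ 2 + 2 * a * c - 777) * x ^ 2 +
      (2 * b * c - 434) * x + (c ^ 2 - 77) = 0 := by
    linear_combination (a * x ^ 2 + b * x + c + y) * hg₁ + hy
  have Hw : (a ^ 2 - 112) * (σ x) ^ 4 + (2 * a * b - 476) * (σ x) ^ 3 +
      (b ^ 2 + 2 * a * c - 777) * (σ x) ^ 2 + (2 * b * c - 434) * (σ x) + (c ^ 2 - 77) = 0 := by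
    linear_combination (a * (σ x) ^ 2 + b * (σ x) + c + σ y) * hg₂ + hy'
  obtain ⟨hE0, hE1, -, hHt⟩ := quartic_vieta_of_three_roots Hu Hv Hw huv huw hvw
  -- the leading coefficient: `a ∈ ℚ + ℚ r`, so `a² ≠ 112`
  have ha : a ^ 2 - 112 ≠ 0 := by
    obtain ⟨p, q, hpq⟩ := hfix a hσa
    intro h
    exact sq_ne_112_of_mem_span_sqrt_five hr p q (by rw [← hpq]; linear_combination h)
  -- the fourth intersection point `(x₃, y₃)` of the parabola with `X(e7)`
  obtain ⟨x₃, hx₃⟩ : ∃ x₃ : K,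
      (a ^ 2 - 112) * x₃ = -(2 * a * b - 476) - (a ^ 2 - 112) * (-1 / 3 + x + σ x) :=
    ⟨(-(2 * a * b - 476) - (a ^ 2 - 112) * (-1 / 3 + x + σ x)) / (a ^ 2 - 112),
      mul_div_cancel₀ _ ha⟩
  have Hx₃ := hHt x₃ hx₃
  obtain ⟨y₃, hy₃⟩ : ∃ y₃ : K, y₃ = a * x₃ ^ 2 + b * x₃ + c := ⟨_, rfl⟩
  have hcurve₃ : y₃ ^ 2 = 7 * (16 * x₃ ^ 4 + 68 * x₃ ^ 3 + 111 * x₃ ^ 2 + 62 * x₃ + 11) := by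
    rw [hy₃]
    linear_combination Hx₃
  -- it is `σ`-fixed, hence a `k`-point
  have hσx₃ : σ x₃ = x₃ := by
    have h := congrArg σ hx₃
    simp only [map_mul, map_sub, map_neg, map_add, map_pow, map_ofNat, hσa, hσb, hσu, hinv] at h
    apply mul_left_cancel₀ ha
    rw [h, hx₃]
    ring
  have hσy₃ : σ y₃ = y₃ := by
    rw [hy₃, map_add, map_add, map_mul, map_mul, map_pow, hσa, hσb, hσcc, hσx₃]
  -- by the point list, `x₃ = −1/3`: `O` is a double intersection point
  have h3x₃ : 3 * x₃ + 1 = 0 := hE7k K hd r hr x₃ y₃ (hfix x₃ hσx₃) (hfix y₃ hσy₃) hcurve₃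
  have hX3 : (a ^ 2 - 112) * (-1 / 3) = -(2 * a * b - 476) - (a ^ 2 - 112) * (-1 / 3 + x + σ x) := by
    have h : x₃ = -1 / 3 := by linear_combination h3x₃ / 3
    linear_combination hx₃ - (a ^ 2 - 112) * h
  exact e7_neg_relation hg₀ hE0 hE1 hX3 ha

/-! ## 5. `CertB3E7` BY NAME with NF-E10-MW replaced by the bare `k`-point list -/

set_option maxHeartbeats 1000000 in -- four written-out hypothesis types with `decide`d matrix entries; statement elaboration only
/-- **`CertB3E7` BY NAME from the WEAKER model identification NF-K1-E10∞ (`hK1inf`, p672401: the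
chart at infinity as an honest third disjunct, empty over quartic `K ∋ √5`), the BARE `k`-POINT LIST
`hE7k`, and the certified census (`hZmm`, `hZmi`):**
`certB3E7_of_modelIdentification_inf_of_census hK1inf (mordellWeilE7_of_kPoints hE7k) hZmm hZmi`
(with p670569's `hK1` instead: `certB3E7 hK1 (mordellWeilE7_of_kPoints hE7k) hZmm hZmi`, same shape).
With this, sheet 4.5 rests on {ModelIdentificationB3E7Inf, the rank-`0` point list
`X(e7)(ℚ(√5)) ⊂ {x = −1/3}` (certnum l.140 + Kolyvagin–Logachev, NAMED), CensusMM, CensusMI} — the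
group law and the chart at infinity are kernel theorems.  CONDITIONAL; «a certified finite datum is
not a modularity statement»; nothing here proves modularity of a new class.
[cite: FreitasLeHungSiksek2015, Lemma 4.2 (p. 28)] [cite: Box2022, §1.1 and Thm. 7.1] -/
theorem certB3E7_of_modelIdentification_inf_of_kPoints_of_census
    (hK1inf : ∀ (K : Type) [Field K] [NumberField K], Module.finrank ℚ K = 4 → (∃ r : K, r ^ 2 = 5) →
        ∀ E : WeierstrassCurve (NumberField.RingOfIntegers K), E.Δ ≠ 0 →
          (∃ ρ : Literature.NumberTheory.GaloisRepresentations.FramedGaloisRep K (ZMod 3) 2, (∃ e : (E.baseChange K).geomTorsion ((3 : ℕ) : ℤ) ≃+ (Fin 2 → ZMod 3), ∀ (σ : Field.absoluteGaloisGroup K) (P : (E.baseChange K).geomTorsion ((3 : ℕ) : ℤ)), e (σ • P) = ((ρ σ : GL (Fin 2) (ZMod 3)) : Matrix (Fin 2) (Fin 2) (ZMod 3)) *ᵥ (e P)) ∧ ((∀ σ : Field.absoluteGaloisGroup K, (((ρ σ : GL (Fin 2) (ZMod 3)) : Matrix (Fin 2) (Fin 2) (ZMod 3)) 1 0 = 0))))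 →
          (∃ ρ : Literature.NumberTheory.GaloisRepresentations.FramedGaloisRep K (ZMod 7) 2, (∃ e : (E.baseChange K).geomTorsion ((7 : ℕ) : ℤ) ≃+ (Fin 2 → ZMod 7), ∀ (σ : Field.absoluteGaloisGroup K) (P : (E.baseChange K).geomTorsion ((7 : ℕ) : ℤ)), e (σ • P) = ((ρ σ : GL (Fin 2) (ZMod 7)) : Matrix (Fin 2) (Fin 2) (ZMod 7)) *ᵥ (e P)) ∧ ((∀ σ : Field.absoluteGaloisGroup K, (ρ σ : GL (Fin 2) (ZMod 7)) ∈ Subgroup.closure ({(⟨!![0, 5; 3, 0], !![0, 5; 3, 0], by decide, by decide⟩ : GL (Fin 2) (ZMod 7)), (⟨!![5, 0; 3, 2], !![3, 0; 6, 4], by decide, by decide⟩ : GL (Fin 2) (ZMod 7))} : Set (GL (Fin 2) (ZMod 7)))))) →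
          ((E.baseChange K).c₄ ^ 3 = 1728 * (E.baseChange K).Δ ∨
           (∃ x₁ y₁ x₂ y₂ : K, y₁ ^ 2 = 7 * (16 * x₁ ^ 4 + 68 * x₁ ^ 3 + 111 * x₁ ^ 2 + 62 * x₁ + 11) ∧ y₂ ^ 2 = 7 * (16 * x₂ ^ 4 + 68 * x₂ ^ 3 + 111 * x₂ ^ 2 + 62 * x₂ + 11) ∧
            ((x₁ ^ 3 + x₁ ^ 2 - 2 * x₁ - 1) ^ 7) ≠ 0 ∧
            (E.baseChange K).c₄ ^ 3 * ((x₁ ^ 3 + x₁ ^ 2 - 2 * x₁ - 1) ^ 7) = ((3 * x₁ + 1) ^ 3 * (4 * x₁ ^ 2 + 5 * x₁ + 2) ^ 3 * (x₁ ^ 2 + 3 * x₁ + 4) ^ 3 * (x₁ ^ 2 + 10 * x₁ + 4) ^ 3) * (E.baseChange K).Δ ∧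
            ((3 * x₂ ^ 2 + 6 * x₂ + 2) ^ 2 * x₁ ^ 4 + (36 * x₂ ^ 4 + 125 * x₂ ^ 3 + 138 * x₂ ^ 2 + 60 * x₂ + 9) * x₁ ^ 3 + (48 * x₂ ^ 4 + 138 * x₂ ^ 3 + 111 * x₂ ^ 2 + 33 * x₂ + 3) * x₁ ^ 2 + (24 * x₂ ^ 4 + 60 * x₂ ^ 3 + 33 * x₂ ^ 2 + 5 * x₂) * x₁ + (4 * x₂ ^ 4 + 9 * x₂ ^ 3 + 3 * x₂ ^ 2)) = 0) ∨
           (∃ x₁ y₁ z : K, y₁ ^ 2 = 7 * (16 * x₁ ^ 4 + 68 * x₁ ^ 3 + 111 * x₁ ^ 2 + 62 * x₁ + 11) ∧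
            ((x₁ ^ 3 + x₁ ^ 2 - 2 * x₁ - 1) ^ 7) ≠ 0 ∧
            (E.baseChange K).c₄ ^ 3 * ((x₁ ^ 3 + x₁ ^ 2 - 2 * x₁ - 1) ^ 7) = ((3 * x₁ + 1) ^ 3 * (4 * x₁ ^ 2 + 5 * x₁ + 2) ^ 3 * (x₁ ^ 2 + 3 * x₁ + 4) ^ 3 * (x₁ ^ 2 + 10 * x₁ + 4) ^ 3) * (E.baseChange K).Δ ∧
            (3 * x₁ ^ 2 + 6 * x₁ + 2) ^ 2 = 0 ∧ z ^ 2 = 7)))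
    (hE7k : ∀ (K : Type) [Field K] [NumberField K], Module.finrank ℚ K = 4 → ∀ r : K, r ^ 2 = 5 →
        ∀ x y : K, (∃ a b : ℚ, x = (a : K) + (b : K) * r) → (∃ a b : ℚ, y = (a : K) + (b : K) * r) →
          y ^ 2 = 7 * (16 * x ^ 4 + 68 * x ^ 3 + 111 * x ^ 2 + 62 * x + 11) → 3 * x + 1 = 0)
        (hZmm : ∀ (K : Type) [Field K] [NumberField K], Module.finrank ℚ K = 4 → (∃ r : K, r ^ 2 = 5) →
        ∀ x₁ y₁ x₂ x₁' x₂' : K, y₁ ^ 2 = 7 * (16 * x₁ ^ 4 + 68 * x₁ ^ 3 + 111 * x₁ ^ 2 + 62 * x₁ + 11) →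
          ((3 * x₂ ^ 2 + 6 * x₂ + 2) ^ 2 * x₁ ^ 4 + (36 * x₂ ^ 4 + 125 * x₂ ^ 3 + 138 * x₂ ^ 2 + 60 * x₂ + 9) * x₁ ^ 3 + (48 * x₂ ^ 4 + 138 * x₂ ^ 3 + 111 * x₂ ^ 2 + 33 * x₂ + 3) * x₁ ^ 2 + (24 * x₂ ^ 4 + 60 * x₂ ^ 3 + 33 * x₂ ^ 2 + 5 * x₂) * x₁ + (4 * x₂ ^ 4 + 9 * x₂ ^ 3 + 3 * x₂ ^ 2)) = 0 →
          (12 * x₁ + 5) * x₁' = -(5 * x₁ + 2) → (12 * x₂ + 5) * x₂' = -(5 * x₂ + 2) →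
          ((3 * x₂' ^ 2 + 6 * x₂' + 2) ^ 2 * x₁' ^ 4 + (36 * x₂' ^ 4 + 125 * x₂' ^ 3 + 138 * x₂' ^ 2 + 60 * x₂' + 9) * x₁' ^ 3 + (48 * x₂' ^ 4 + 138 * x₂' ^ 3 + 111 * x₂' ^ 2 + 33 * x₂' + 3) * x₁' ^ 2 + (24 * x₂' ^ 4 + 60 * x₂' ^ 3 + 33 * x₂' ^ 2 + 5 * x₂') * x₁' + (4 * x₂' ^ 4 + 9 * x₂' ^ 3 + 3 * x₂' ^ 2)) = 0 →
          (3 * x₁ + 1 = 0 ∨ x₁ ^ 2 + 10 * x₁ + 4 = 0))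
        (hZmi : ∀ (K : Type) [Field K] [NumberField K], Module.finrank ℚ K = 4 → (∃ r : K, r ^ 2 = 5) →
        ∀ x₁ y₁ x₂ x₁' : K, y₁ ^ 2 = 7 * (16 * x₁ ^ 4 + 68 * x₁ ^ 3 + 111 * x₁ ^ 2 + 62 * x₁ + 11) →
          ((3 * x₂ ^ 2 + 6 * x₂ + 2) ^ 2 * x₁ ^ 4 + (36 * x₂ ^ 4 + 125 * x₂ ^ 3 + 138 * x₂ ^ 2 + 60 * x₂ + 9) * x₁ ^ 3 + (48 * x₂ ^ 4 + 138 * x₂ ^ 3 + 111 * x₂ ^ 2 + 33 * x₂ + 3) * x₁ ^ 2 + (24 * x₂ ^ 4 + 60 * x₂ ^ 3 + 33 * x₂ ^ 2 + 5 * x₂) * x₁ + (4 * x₂ ^ 4 + 9 * x₂ ^ 3 + 3 * x₂ ^ 2)) = 0 →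
          (12 * x₁ + 5) * x₁' = -(5 * x₁ + 2) →
          ((3 * x₂ ^ 2 + 6 * x₂ + 2) ^ 2 * x₁' ^ 4 + (36 * x₂ ^ 4 + 125 * x₂ ^ 3 + 138 * x₂ ^ 2 + 60 * x₂ + 9) * x₁' ^ 3 + (48 * x₂ ^ 4 + 138 * x₂ ^ 3 + 111 * x₂ ^ 2 + 33 * x₂ + 3) * x₁' ^ 2 + (24 * x₂ ^ 4 + 60 * x₂ ^ 3 + 33 * x₂ ^ 2 + 5 * x₂) * x₁' + (4 * x₂ ^ 4 + 9 * x₂ ^ 3 + 3 * x₂ ^ 2)) = 0 →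
          3 * x₁ + 1 = 0) :
    Summit.Langlands.Langlands.Theses.SqrtFiveQuarticCovers.CertB3E7 :=
  certB3E7_of_modelIdentification_inf_of_census hK1inf (mordellWeilE7_of_kPoints hE7k) hZmm hZmi

end Summit.Langlands.Langlands.Theorems.SqrtFiveQuarticCovers
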